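import Mathlib
import Summits.QuantumFields.QCD.Theorems.WilsonQuarkChessboardBackgroundSchwarzSpin

/-!
# Entries of the rotated Wilson–Dirac operator in time-slice coordinates (helper for `BackgroundSchwarz`)

Sites of the four-torus are written `Fin.cons t xs` (time `t : ZMod L`, spatial `xs : Fin 3 → ZMod L`)
and spin indices `spin4[σ, s]`.  We record

* `rotD_apply_cons`: the entry `D'[W]_{(t,xs,a,α),(t',ys,b,β)}` as mass term + time-like forward
  (`t' = t + 1`) / backward (`t = t' + 1`) hops + spatial hops (`t = t'`);
* `rotD_apTw_congr_of_pos`: entries between indices of times `≤ L/2` only see the links of the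
  closed positive half (locality of the positive blocks);
* `rotD_apply_eq_zero_of_time`: entries vanish unless the times are equal or adjacent with the
  spins allowed by the projections `rotF[0] = -diag(0,0,1,1)`, `rotG[0] = -diag(1,1,0,0)`;
* small `ZMod L` bookkeeping (`val` of successors and negatives).
-/

noncomputable section

namespace Summit.QuantumFields.QCD.Theorems.BackgroundSchwarz

open Matrix Complex Finset
open Literature.MathematicalPhysics Literature.MathematicalPhysics.QuantumLattice
  Literature.MathematicalPhysics.QuantumFieldTheory Literature.Probability.LatticeModels

variable {L N : ℕ} [NeZero L] {G : Type*} [Group G] (ρ : G →* Matrix (Fin N) (Fin N) ℂ)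

/-! ## Sites in time-slice coordinates -/

omit [NeZero L] in
/-- The time-like shift in time-slice coordinates. -/
theorem shift_cons_zero (t : ZMod L) (xs : Fin 3 → ZMod L) :
    QuantumFieldTheory.Site.shift (Fin.cons t xs : TorusSite 4 L) 0 = Fin.cons (t + 1) xs := by
  funext j
  refine Fin.cases ?_ (fun k => ?_) j
  · simp [QuantumFieldTheory.Site.shift]
  · simp [QuantumFieldTheory.Site.shift]

omit [NeZero L] in
/-- A spatial shift in time-slice coordinates. -/
theorem shift_cons_succ (t : ZMod L) (xs : Fin 3 → ZMod L) (k : Fin 3) :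
    QuantumFieldTheory.Site.shift (Fin.cons t xs : TorusSite 4 L) k.succ = Fin.cons t (xs + Pi.single k 1) := by
  funext j
  refine Fin.cases ?_ (fun i => ?_) j
  · simp [QuantumFieldTheory.Site.shift]
  · simp only [QuantumFieldTheory.Site.shift, Pi.add_apply, Fin.cons_succ]
    by_cases h : i = k
    · subst h; simp
    · rw [Pi.single_eq_of_ne h, Pi.single_eq_of_ne (fun h' => h (Fin.succ_injective _ h'))]

omit [NeZero L] in
/-- The site reflection in time-slice coordinates. -/
theorem θsite_cons (t : ZMod L) (xs : Fin 3 → ZMod L) :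
    θsite[(Fin.cons t xs : TorusSite 4 L)] = Fin.cons (-t) xs := by
  funext j
  refine Fin.cases ?_ (fun i => ?_) j
  · simp
  · rw [Function.update_of_ne (Fin.succ_ne_zero i)]; rfl

omit [NeZero L] in
/-- Every site is `Fin.cons` of its time and its spatial part. -/
theorem cons_self (x : TorusSite 4 L) : Fin.cons (x 0) (Fin.tail x) = x := Fin.cons_self_tail x

/-! ## The master entry formula -/

omit [NeZero L] in
/-- **Entries of `D'[W]` in time-slice coordinates**: mass term, time-like forward/backward hops
(`t' = t + 1` / `t = t' + 1`, same spatial site) and spatial forward/backward hops (same time). -/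
theorem rotD_apply_cons (W : GaugeConfig 4 L G) (m : ℝ) (t t' : ZMod L) (xs ys : Fin 3 → ZMod L)
    (a b : Fin N) (α β : Fin 4) :
    rotD[ρ, W, m] ((Fin.cons t xs : TorusSite 4 L), a, α) ((Fin.cons t' ys : TorusSite 4 L), b, β) =
      (if t = t' ∧ xs = ys ∧ a = b ∧ α = β then ((m + 4 : ℝ) : ℂ) else 0) +
      (((if t' = t + 1 ∧ ys = xs then rotF[(0 : Fin 4)] α β * ρ (W (Fin.cons t xs, 0)) a b else 0) +
        (if t = t' + 1 ∧ xs = ys then rotG[(0 : Fin 4)] α β * ρ (W (Fin.cons t' ys, 0))⁻¹ a b else 0)) +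
      ∑ k : Fin 3,
        ((if t' = t ∧ ys = xs + Pi.single k 1 then
            rotF[k.succ] α β * ρ (W (Fin.cons t xs, k.succ)) a b else 0) +
         (if t = t' ∧ xs = ys + Pi.single k 1 then
            rotG[k.succ] α β * ρ (W (Fin.cons t' ys, k.succ))⁻¹ a b else 0))) := by
  have h1 : ∀ (c : ℂ) (p q : TorusSite 4 L × Fin N × Fin 4),
      (c • (1 : Matrix (TorusSite 4 L × Fin N × Fin 4) (TorusSite 4 L × Fin N × Fin 4) ℂ)) p q =
        if p = q then c else 0 := fun c p q => by
    rw [Matrix.smul_apply, Matrix.one_apply, smul_eq_mul, mul_ite, mul_one, mul_zero]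
  simp only [Matrix.add_apply, h1, Matrix.sum_apply, Matrix.of_apply, Fin.sum_univ_succ (n := 3),
    shift_cons_zero, shift_cons_succ, Fin.cons_inj, Prod.mk.injEq, and_assoc]


/-! ## `ZMod L` bookkeeping through `val` -/

omit [NeZero L] in
/-- Equality in `ZMod L` is equality of representatives. -/
theorem zmod_eq_iff_val [NeZero L] (t t' : ZMod L) : t = t' ↔ t.val = t'.val :=
  (ZMod.val_injective L).eq_iff.symm

/-- The representative of a successor. -/
theorem val_add_one [Fact (1 < L)] (t : ZMod L) :
    (t + 1).val = if t.val + 1 = L then 0 else t.val + 1 := by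
  rw [ZMod.val_add, ZMod.val_one]
  have ht := ZMod.val_lt t
  split_ifs with h
  · rw [h, Nat.mod_self]
  · exact Nat.mod_eq_of_lt (by omega)

/-- The representative of a negative. -/
theorem val_neg_eq (t : ZMod L) : (-t).val = if t.val = 0 then 0 else L - t.val := by
  rw [ZMod.neg_val]
  simp only [ZMod.val_eq_zero]

/-! ## Locality: the positive blocks only see the positive half -/

section Locality

variable (ρU : Matrix.unitaryGroup (Fin N) ℂ →* Matrix (Fin N) (Fin N) ℂ)

/-- **Locality of the positive blocks.**  If two `U(N)` fields agree on the closed positive half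
(`posE`), the entries of their twisted rotated Wilson–Dirac operators agree between all indices of
times `≤ L/2` (every link met by such an entry lies in the closed positive half; the seams of the
twist do not depend on the field). -/
theorem rotD_apTw_congr_of_pos [Fact (1 < L)] (hL : 4 ≤ L)
    (V₁ V₂ : GaugeConfig 4 L (Matrix.unitaryGroup (Fin N) ℂ))
    (hV : ∀ e : Edge 4 L, posE[L, e] → V₁ e = V₂ e) (m : ℝ)
    (p q : TorusSite 4 L × Fin N × Fin 4) (hp : (p.1 0).val ≤ L / 2) (hq : (q.1 0).val ≤ L / 2) :
    rotD[ρU, apTw[L, V₁], m] p q = rotD[ρU, apTw[L, V₂], m] p q := by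
  obtain ⟨x, a, α⟩ := p
  obtain ⟨y, b, β⟩ := q
  rw [← cons_self x, ← cons_self y] at *
  simp only [Fin.cons_zero] at hp hq
  rw [rotD_apply_cons ρU (apTw[L, V₁]) m, rotD_apply_cons ρU (apTw[L, V₂]) m]
  have hx := ZMod.val_lt (x 0)
  have hy := ZMod.val_lt (y 0)
  congr 2
  · congr 1
    · by_cases h : y 0 = x 0 + 1 ∧ Fin.tail y = Fin.tail x
      · have h1 := congrArg ZMod.val h.1
        rw [val_add_one] at h1
        rw [if_pos h, if_pos h, hV _ (by
          simp only [if_true, Fin.cons_zero]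
          split_ifs at h1 <;> omega)]
      · rw [if_neg h, if_neg h]
    · by_cases h : x 0 = y 0 + 1 ∧ Fin.tail x = Fin.tail y
      · have h1 := congrArg ZMod.val h.1
        rw [val_add_one] at h1
        rw [if_pos h, if_pos h, hV _ (by
          simp only [if_true, Fin.cons_zero]
          split_ifs at h1 <;> omega)]
      · rw [if_neg h, if_neg h]
  · refine Finset.sum_congr rfl fun k _ => ?_
    congr 1
    · by_cases h : y 0 = x 0 ∧ Fin.tail y = Fin.tail x + Pi.single k 1
      · rw [if_pos h, if_pos h, hV _ (by
          simp only [Fin.succ_ne_zero, if_false, Fin.cons_zero]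
          exact hp)]
      · rw [if_neg h, if_neg h]
    · by_cases h : x 0 = y 0 ∧ Fin.tail x = Fin.tail y + Pi.single k 1
      · rw [if_pos h, if_pos h, hV _ (by
          simp only [Fin.succ_ne_zero, if_false, Fin.cons_zero]
          exact hq)]
      · rw [if_neg h, if_neg h]

end Locality

/-! ## Vanishing entries -/

omit [NeZero L] in
/-- **Vanishing of entries**: between different times the only couplings are the time-like hops,
forward (`t' = t + 1`) through `rotF[0]` (both spins in the `-` block) and backward (`t = t' + 1`)
through `rotG[0]` (both spins in the `+` block). -/
theorem rotD_cons_eq_zero (W : GaugeConfig 4 L G) (m : ℝ) (t t' : ZMod L) (xs ys : Fin 3 → ZMod L)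
    (a b : Fin N) (σ s σ' s' : Fin 2) (h0 : t ≠ t') (h1 : t' = t + 1 → ¬(σ = 1 ∧ σ' = 1))
    (h2 : t = t' + 1 → ¬(σ = 0 ∧ σ' = 0)) :
    rotD[ρ, W, m] ((Fin.cons t xs : TorusSite 4 L), a, spin4[σ, s])
      ((Fin.cons t' ys : TorusSite 4 L), b, spin4[σ', s']) = 0 := by
  rw [rotD_apply_cons, if_neg (fun h => h0 h.1)]
  rw [Finset.sum_eq_zero (fun k _ => by
    rw [if_neg (fun h => h0 h.1.symm), if_neg (fun h => h0 h.1), add_zero])]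
  rw [zero_add, add_zero]
  have hF : (t' = t + 1 ∧ ys = xs) → rotF[(0 : Fin 4)] (spin4[σ, s]) (spin4[σ', s']) = 0 := fun h => by
    rw [rotF_zero_spin4, if_neg (fun h' => h1 h.1 ⟨h'.1, h'.2.1⟩)]
  have hG : (t = t' + 1 ∧ xs = ys) → rotG[(0 : Fin 4)] (spin4[σ, s]) (spin4[σ', s']) = 0 := fun h => by
    rw [rotG_zero_spin4, if_neg (fun h' => h2 h.1 ⟨h'.1, h'.2.1⟩)]
  rw [show (if t' = t + 1 ∧ ys = xs then
        rotF[(0 : Fin 4)] (spin4[σ, s]) (spin4[σ', s']) * ρ (W (Fin.cons t xs, 0)) a b else 0) = 0 by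
      split_ifs with h
      · rw [hF h, zero_mul]
      · rfl,
    show (if t = t' + 1 ∧ xs = ys then
        rotG[(0 : Fin 4)] (spin4[σ, s]) (spin4[σ', s']) * ρ (W (Fin.cons t' ys, 0))⁻¹ a b else 0) = 0 by
      split_ifs with h
      · rw [hG h, zero_mul]
      · rfl, add_zero]

end Summit.QuantumFields.QCD.Theorems.BackgroundSchwarz
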